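import Summits.BirchSwinnertonDyer.BirchSwinnertonDyer.Theorems.PrintCf2SplitBadTwoRestrictedSelmerControlIndex
import Summits.BirchSwinnertonDyer.BirchSwinnertonDyer.Theorems.PrintCf2SplitBadTwoRestrictedSelmerControlSkeleton
import HarnessLib

/-!
# Crux `PrintCf2.SplitBadTwoRankOneOfFacts` (stmt-BirchSwinnertonDyer-20368), road α v9.1 — brick B16 file 4:
# the COKERNEL of Agboola's control map is bounded by the PRODUCT OF THE LOCAL KERNELS (snake-lemma packaging)

Cell `bsd-print-cf2`, width seat `bsd-line-cf2-p1-w3` g7 (prover-bsd-line-cf2-p1-w3-g7-0); brick B16 (LEAD g11 18:21:06Z) — the glue that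
lets the LOCAL values of files 2–3 enter -w7's four-index identity (p652120 `hasCharValuationAt_control_identity`: the cokernel index
`[𝔖^Γ : res 𝔖_𝔮(K, M)]` was left ABSTRACT; -w7's skeleton p649994 gives only the surjectivity criterion `control_surjective_of_local`).
`--supports stmt-BirchSwinnertonDyer-20368` (helper, Theses-free). HONEST FRAMING: nothing here closes the crux or a registered stub; BSD
is not proved by any of this; no summit statement is proved by this seat. No definition, no named fact, no `sorry`.

WHAT (generic: `K` a number field, `κ` a `ℤ_p`-extension with topological generator `γ`, `M` a discrete `p`-primary `Γ_K`-module
with continuous orbit maps, `𝔮` a place; `H_0 = κ.layerSubgroup 0`, `H_∞ = ker κ`, `D_w = GreenbergSelmer.decomp w`, local kernels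
`LK_w := ker (H¹(H_0 ⊓ D_w, M) → H¹(H_∞ ⊓ D_w, M))` of `resOfLe_local_lift_eq_zero`):
* §1 `conjH1_layer_zero` (inner automorphisms act trivially on `H¹(H_0, M)`), `resOfLe_mem_localKer_of_comap` (for `x ∈ H¹(H_0, M)` with
  `res x ∈ 𝔖_𝔮(K_∞, M)`, every local class `loc_w x` lies in `LK_w`), `mem_restrictedSelmer_layer_zero_iff_of_localKer_eq_bot`
  (if `LK_w = ⊥` at every finite `w ∤ p` outside a finite set `T ∋ 𝔮` and the infinite decomposition groups lie in `H_∞`, then such an `x`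
  lies in `𝔖_𝔮(K_0, M)` iff its local classes at the places of `T` vanish);
* §2 **`relIndex_image_endInvariants_le_prod_card_localKer`** — THE COKERNEL BOUND: under the same hypotheses and with `LK_w` finite for
  `w ∈ T`, **`[𝔖_𝔮(K_∞, M)^Γ : res 𝔖_𝔮(K, M)] ≤ ∏_{w ∈ T} #LK_w`** in -w7's currency
  (`((restrictedSelmerBase M p 𝔮).map res).addSubgroupOf (restrictedSelmerZp κ M 𝔮)` inside `endInvariants (conjRestricted κ M 𝔮 γ − 1)`).
  Proof = Greenberg's snake: every `Γ`-invariant class lifts to `H¹(K, M)` (`exists_resOfLe_eq_of_conjH1_eq`, `cd_p Γ = 1`), the lift is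
  in `𝔖_𝔮(K, M)` iff its `T`-local classes vanish (§1), so `𝔖^Γ / res 𝔖_𝔮(K, M)` is a quotient of `B′/𝔖_𝔮(K_0, M) ↪ ∏_{w∈T} LK_w`,
  `B′ = res⁻¹ 𝔖_𝔮(K_∞, M)`.
For road α (`p = 2`, `M = W*`, `κ*` unramified outside `𝔮 = v̄`, `K = ℚ(√−7)`): by files 2–3 (`…LocalControlKernelInertia/Good`) the finite
places `w ∤ 2` with `LK_w ≠ 0` are among the additive `w ∣ 7d`, each with `#LK_w ≤ 2`; `v` carries no condition; the archimedean place is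
complex. So `v₂ [𝔖^Γ : res] ≤ #{w ∣ 7d} + v₂ #LK_{v̄}` — the cokernel term of the four-index identity is CLASS-BOUNDED modulo the single
dyadic local kernel at `v̄` (B15). presearch: Greenberg LNM 1716 §3 Lemmas 3.1–3.3 and the snake diagram p. 85 ("`ker(s_n) … coker(s_n)`");
Agboola 2007 Prop. 3.2 ("the cokernel … is bounded by the orders of the kernels of the local restriction maps") — held; not in the tree as
an index bound (only `control_surjective_of_local`). beyond-print theorem: no.

References: [GreenbergLNM1716] §3 (snake diagram p. 85; Lemmas 3.1–3.3 pp. 86–88); [Agboola2007] §3 Prop. 3.2 (arXiv p0008:L128–135, L197);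
[NeukirchSchmidtWingberg2008] I §5–6; [SerreLocalFields1979] VII §5 Prop. 3.
-/

noncomputable section

open scoped Classical

set_option linter.dupNamespace false
set_option autoImplicit false

open NumberField IsDedekindDomain Field
open Literature.NumberTheory.EllipticCurves Literature.NumberTheory.EllipticCurves.GreenbergSelmer
open Literature.NumberTheory.EllipticCurves.Castella2018.AcSelmer
open Literature.NumberTheory.EllipticCurves.Agboola2007
open Literature.NumberTheory.EllipticCurves.IwasawaDual
open Literature.NumberTheory.EllipticCurves.ResKernel
open Literature.NumberTheory.GaloisRepresentations

universe u

namespace Summit.BirchSwinnertonDyer.BirchSwinnertonDyer.Theorems.PrintCf2.RestrictedSelmerPair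

section Coker

variable {K : Type u} [Field K] [NumberField K] {p : ℕ} [Fact p.Prime] (κ : ZpExtension K p)
  (M : Type u) [AddCommGroup M] [DistribMulAction (absoluteGaloisGroup K) M]
  [TopologicalSpace M] [DiscreteTopology M] (𝔮 : HeightOneSpectrum (𝓞 K))

/-! ## §1. Layer `0`: conjugation is trivial; local classes of lifts lie in the local kernels -/

omit [NumberField K] in
/-- **Inner automorphisms act trivially on `H¹(H_0, M)`**: `H_0 = κ.layerSubgroup 0 = ⊤` contains every `σ`
(`conjH1_of_mem`). [cite: SerreLocalFields1979, VII §5 Prop. 3] -/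
theorem conjH1_layer_zero (σ : absoluteGaloisGroup K) (x : subgroupH1 (κ.layerSubgroup 0) M) :
    conjH1 (κ.layerSubgroup 0) M σ x = x := by
  have hσ : σ ∈ κ.layerSubgroup 0 := by rw [ZpExtension.layerSubgroup_zero]; trivial
  rw [conjH1_of_mem_holds (κ.layerSubgroup 0) M hσ, AddMonoidHom.id_apply]

/-- **Local classes of a lift lie in the local kernels**: if `x ∈ H¹(H_0, M)` restricts into `𝔖_𝔮(K_∞, M)`, then at every finite
`w ∤ p` and at `w = 𝔮` its local class `loc_w x ∈ H¹(H_0 ⊓ D_w, M)` lies in `LK_w = ker (H¹(H_0 ⊓ D_w, M) → H¹(H_∞ ⊓ D_w, M))`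
(-w7's `resOfLe_local_lift_eq_zero` at `σ = 1`, `n = 0`). [cite: Agboola2007, §3 Prop. 3.2] [cite: GreenbergLNM1716, §3 (the maps r_v)] -/
theorem resOfLe_mem_localKer_of_comap {x : subgroupH1 (κ.layerSubgroup 0) M}
    (hx : resOfLe M (κ.kerSubgroup_le_layerSubgroup 0) x ∈ restrictedSelmer κ.kerSubgroup M p 𝔮)
    (w : HeightOneSpectrum (𝓞 K)) (hw : ((p : ℕ) : 𝓞 K) ∉ w.asIdeal ∨ w = 𝔮) :
    resOfLe M (inf_le_left : κ.layerSubgroup 0 ⊓ decomp w ≤ κ.layerSubgroup 0) x ∈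
      (resOfLe M (inf_le_inf_right (decomp w) (κ.kerSubgroup_le_layerSubgroup 0) :
        κ.kerSubgroup ⊓ decomp w ≤ κ.layerSubgroup 0 ⊓ decomp w)).ker := by
  obtain ⟨hfin, -, h𝔮⟩ := resOfLe_local_lift_eq_zero κ M 𝔮 0 hx 1
  rw [AddMonoidHom.mem_ker]
  rcases hw with hw | rfl
  · have h := hfin w hw
    rwa [conjH1_layer_zero] at h
  · rwa [conjH1_layer_zero] at h𝔮

/-- **Membership in `𝔖_𝔮(K_0, M)` is decided at finitely many places.** Let `T ∋ 𝔮` be a finite set of places such that the local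
kernel `LK_w` vanishes at every finite `w ∤ p` outside `T`, and suppose the infinite decomposition groups lie in `H_∞` (the line is
unramified at infinity — automatic for an imaginary quadratic `K`). Then an `x ∈ H¹(H_0, M)` whose restriction lies in `𝔖_𝔮(K_∞, M)`
belongs to `𝔖_𝔮(K_0, M)` iff its local classes vanish at the places `w ∈ T` with `w ∤ p` or `w = 𝔮`.
[cite: Agboola2007, §3 Prop. 3.2] [cite: GreenbergLNM1716, §3 Lemma 3.3 and p. 86 (archimedean places)] -/
theorem mem_restrictedSelmer_layer_zero_iff_of_localKer_eq_bot (T : Finset (HeightOneSpectrum (𝓞 K))) (h𝔮T : 𝔮 ∈ T)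
    (hT : ∀ w : HeightOneSpectrum (𝓞 K), w ∉ T → ((p : ℕ) : 𝓞 K) ∉ w.asIdeal →
      (resOfLe M (inf_le_inf_right (decomp w) (κ.kerSubgroup_le_layerSubgroup 0) :
        κ.kerSubgroup ⊓ decomp w ≤ κ.layerSubgroup 0 ⊓ decomp w)).ker = ⊥)
    (hinf : ∀ w : InfinitePlace K, decompInf w ≤ κ.kerSubgroup)
    {x : subgroupH1 (κ.layerSubgroup 0) M}
    (hx : resOfLe M (κ.kerSubgroup_le_layerSubgroup 0) x ∈ restrictedSelmer κ.kerSubgroup M p 𝔮) :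
    x ∈ restrictedSelmer (κ.layerSubgroup 0) M p 𝔮 ↔
      ∀ w ∈ T, (((p : ℕ) : 𝓞 K) ∉ w.asIdeal ∨ w = 𝔮) →
        resOfLe M (inf_le_left : κ.layerSubgroup 0 ⊓ decomp w ≤ κ.layerSubgroup 0) x = 0 := by
  rw [mem_restrictedSelmer_iff_resOfLe]
  constructor
  · rintro ⟨hfin, -, h𝔮⟩ w - hw
    rcases hw with hw | rfl
    · have h := hfin w hw 1
      rwa [conjH1_layer_zero] at h
    · have h := h𝔮 1
      rwa [conjH1_layer_zero] at h
  · intro h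
    obtain ⟨-, hinf', -⟩ := resOfLe_local_lift_eq_zero κ M 𝔮 0 hx 1
    refine ⟨fun w hw σ ↦ ?_, fun w σ ↦ ?_, fun σ ↦ ?_⟩
    · rw [conjH1_layer_zero]
      by_cases hwT : w ∈ T
      · exact h w hwT (Or.inl hw)
      · have hmem := resOfLe_mem_localKer_of_comap κ M 𝔮 hx w (Or.inl hw)
        rw [hT w hwT hw, AddSubgroup.mem_bot] at hmem
        exact hmem
    · rw [conjH1_layer_zero]
      have h0 := hinf' w
      rw [conjH1_layer_zero] at h0
      -- the restriction `H¹(H_0 ⊓ D_∞, M) → H¹(H_∞ ⊓ D_∞, M)` is injective: `H_0 ⊓ D_∞ ≤ H_∞ ⊓ D_∞`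
      have hinj := resOfLe_injective_of_ge M
        (inf_le_inf_right (decompInf w) (κ.kerSubgroup_le_layerSubgroup 0) :
          κ.kerSubgroup ⊓ decompInf w ≤ κ.layerSubgroup 0 ⊓ decompInf w)
        (fun g hg ↦ ⟨hinf w hg.2, hg.2⟩)
      exact hinj (by rw [h0, map_zero])
    · rw [conjH1_layer_zero]
      exact h 𝔮 h𝔮T (Or.inr rfl)

/-! ## §2. The cokernel of control is bounded by the product of the local kernels -/

/-- **COKERNEL OF CONTROL ≤ PRODUCT OF LOCAL KERNELS** (Greenberg's snake bound; Agboola Prop. 3.2, cokernel half). `κ` a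
`ℤ_p`-extension of the number field `K` with topological generator `γ`, `M` a discrete `p`-primary `Γ_K`-module with continuous orbit
maps, `𝔮` a place, `T` a finite set of places with `𝔮 ∈ T`, containing no other place above `p`, such that the local kernel
`LK_w = ker (H¹(H_0 ⊓ D_w, M) → H¹(H_∞ ⊓ D_w, M))` VANISHES at every finite `w ∤ p` outside `T` and is FINITE at every `w ∈ T`, and the
line unramified at infinity (`D_∞ ≤ H_∞`). Then in -w7's currency
**`[𝔖_𝔮(K_∞, M)^Γ : res 𝔖_𝔮(K, M)] ≤ ∏_{w ∈ T} #LK_w`.**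
Proof: every `Γ`-invariant class lifts to `H¹(K_0, M)` (`exists_resOfLe_eq_of_conjH1_eq`); a lift lies in `𝔖_𝔮(K_0, M)` iff its
`T`-local classes vanish (§1); so `𝔖^Γ / res 𝔖` is a quotient of `res⁻¹(𝔖_𝔮(K_∞, M)) / 𝔖_𝔮(K_0, M) ↪ ∏_{w ∈ T} LK_w`.
[cite: GreenbergLNM1716, §3 (snake diagram p. 85, Lemmas 3.2–3.3)] [cite: Agboola2007, §3 Prop. 3.2 (arXiv p0008:L128–135, L197)] -/
theorem relIndex_image_endInvariants_le_prod_card_localKer {γ : absoluteGaloisGroup K} (hγ : κ.IsTopGenerator γ)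
    (hcont : ∀ m : M, Continuous fun g : absoluteGaloisGroup K ↦ g • m)
    (hprim : ∀ m : M, ∃ k : ℕ, p ^ k • m = 0)
    (T : Finset (HeightOneSpectrum (𝓞 K))) (h𝔮T : 𝔮 ∈ T)
    (hTp : ∀ w ∈ T, w ≠ 𝔮 → ((p : ℕ) : 𝓞 K) ∉ w.asIdeal)
    (hT : ∀ w : HeightOneSpectrum (𝓞 K), w ∉ T → ((p : ℕ) : 𝓞 K) ∉ w.asIdeal →
      (resOfLe M (inf_le_inf_right (decomp w) (κ.kerSubgroup_le_layerSubgroup 0) :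
        κ.kerSubgroup ⊓ decomp w ≤ κ.layerSubgroup 0 ⊓ decomp w)).ker = ⊥)
    (hinf : ∀ w : InfinitePlace K, decompInf w ≤ κ.kerSubgroup)
    (hfinT : ∀ w ∈ T, Finite (resOfLe M (inf_le_inf_right (decomp w) (κ.kerSubgroup_le_layerSubgroup 0) :
        κ.kerSubgroup ⊓ decomp w ≤ κ.layerSubgroup 0 ⊓ decomp w)).ker) :
    (((restrictedSelmerBase M p 𝔮).map (resOfLe M (le_top : κ.kerSubgroup ≤ ⊤))).addSubgroupOf
        (restrictedSelmerZp κ M 𝔮)).relIndex (endInvariants (conjRestricted κ M 𝔮 γ - 1)) ≤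
      ∏ w ∈ T, Nat.card (resOfLe M (inf_le_inf_right (decomp w) (κ.kerSubgroup_le_layerSubgroup 0) :
        κ.kerSubgroup ⊓ decomp w ≤ κ.layerSubgroup 0 ⊓ decomp w)).ker := by
  -- notation
  set H₀ := κ.layerSubgroup 0 with hH₀
  set R : subgroupH1 H₀ M →+ subgroupH1 κ.kerSubgroup M := resOfLe M (κ.kerSubgroup_le_layerSubgroup 0) with hR
  set Sinf : AddSubgroup (subgroupH1 κ.kerSubgroup M) := restrictedSelmerZp κ M 𝔮 with hSinf
  set S0 : AddSubgroup (subgroupH1 H₀ M) := restrictedSelmer H₀ M p 𝔮 with hS0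
  set inv : AddSubgroup ↥Sinf := endInvariants (conjRestricted κ M 𝔮 γ - 1) with hinv
  set img : AddSubgroup ↥Sinf := ((restrictedSelmerBase M p 𝔮).map
    (resOfLe M (le_top : κ.kerSubgroup ≤ ⊤))).addSubgroupOf Sinf with himg
  let LK : ∀ w : HeightOneSpectrum (𝓞 K), AddSubgroup (subgroupH1 (H₀ ⊓ decomp w) M) := fun w ↦
    (resOfLe M (inf_le_inf_right (decomp w) (κ.kerSubgroup_le_layerSubgroup 0) :
      κ.kerSubgroup ⊓ decomp w ≤ H₀ ⊓ decomp w)).ker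
  -- `B' = R⁻¹ Sinf`
  set B' : AddSubgroup (subgroupH1 H₀ M) := Sinf.comap R with hB'
  have hγ₀ : γ ∈ H₀ := by rw [hH₀, ZpExtension.layerSubgroup_zero]; trivial
  -- the image of the bottom map is `R(𝔖₀)`
  have himg_eq : (restrictedSelmerBase M p 𝔮).map (resOfLe M (le_top : κ.kerSubgroup ≤ ⊤)) = S0.map R := by
    have hcomp : resOfLe M (le_top : κ.kerSubgroup ≤ ⊤) =
        R.comp (resOfLe M (le_top : H₀ ≤ ⊤)) := (resOfLe_comp_holds _ _).symm
    rw [hcomp, ← AddSubgroup.map_map, map_resOfLe_restrictedSelmerBase_eq_layer_zero κ M 𝔮]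
  -- side condition `p ∉ w ∨ w = 𝔮` for `w ∈ T`
  have hTw : ∀ w ∈ T, ((p : ℕ) : 𝓞 K) ∉ w.asIdeal ∨ w = 𝔮 := fun w hw ↦ by
    by_cases h : w = 𝔮
    · exact Or.inr h
    · exact Or.inl (hTp w hw h)
  -- the local map `L : B' → ∏_{w ∈ T} LK_w`
  let Lw : ∀ w : ↥T, ↥B' →+ ↥(LK w.1) := fun w ↦
    { toFun := fun x ↦ ⟨resOfLe M (inf_le_left : H₀ ⊓ decomp w.1 ≤ H₀) (x : subgroupH1 H₀ M),
        resOfLe_mem_localKer_of_comap κ M 𝔮 (AddSubgroup.mem_comap.mp x.2) w.1 (hTw w.1 w.2)⟩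
      map_zero' := Subtype.ext (by simp)
      map_add' := fun a b ↦ Subtype.ext (by simp) }
  let L : ↥B' →+ (∀ w : ↥T, ↥(LK w.1)) := AddMonoidHom.pi Lw
  -- `ker L = S0 ∩ B'`
  have hkerL : L.ker = S0.addSubgroupOf B' := by
    ext x
    rw [AddMonoidHom.mem_ker, AddSubgroup.mem_addSubgroupOf, hS0,
      mem_restrictedSelmer_layer_zero_iff_of_localKer_eq_bot κ M 𝔮 T h𝔮T hT hinf (AddSubgroup.mem_comap.mp x.2)]
    constructor
    · intro h w hw _
      have h1 := congrArg Subtype.val (congrFun h ⟨w, hw⟩)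
      exact h1
    · intro h
      funext w
      exact Subtype.ext (h w.1 w.2 (hTw w.1 w.2))
  -- finiteness and the bound for `B' / S0'`
  haveI : ∀ w : ↥T, Finite ↥(LK w.1) := fun w ↦ hfinT w.1 w.2
  haveI : Finite (∀ w : ↥T, ↥(LK w.1)) := Pi.finite
  haveI hfinQ : Finite (↥B' ⧸ S0.addSubgroupOf B') := by
    rw [← hkerL]
    exact Finite.of_equiv _ (QuotientAddGroup.quotientKerEquivRange L).toEquiv.symm
  have hcardQ : Nat.card (↥B' ⧸ S0.addSubgroupOf B') ≤ ∏ w ∈ T, Nat.card (LK w) := by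
    rw [← hkerL, Nat.card_congr (QuotientAddGroup.quotientKerEquivRange L).toEquiv]
    calc Nat.card L.range ≤ Nat.card (∀ w : ↥T, ↥(LK w.1)) :=
          Nat.card_le_card_of_injective _ L.range.subtype_injective
      _ = ∏ w : ↥T, Nat.card ↥(LK w.1) := Nat.card_pi
      _ = ∏ w ∈ T, Nat.card (LK w) := Finset.prod_coe_sort T (fun w ↦ Nat.card (LK w))
  -- the surjection `Ψ : B' ↠ inv / img`
  have hinvR : ∀ x : ↥B', (⟨R (x : subgroupH1 H₀ M), AddSubgroup.mem_comap.mp x.2⟩ : ↥Sinf) ∈ inv := fun x ↦ by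
    rw [hinv, mem_endInvariants_conjRestricted_iff]
    exact conjH1_resOfLe_of_mem M (κ.kerSubgroup_le_layerSubgroup 0) hγ₀ (x : subgroupH1 H₀ M)
  let Ψ₀ : ↥B' →+ ↥inv :=
    { toFun := fun x ↦ ⟨⟨R (x : subgroupH1 H₀ M), AddSubgroup.mem_comap.mp x.2⟩, hinvR x⟩
      map_zero' := Subtype.ext (Subtype.ext (by simp))
      map_add' := fun a b ↦ Subtype.ext (Subtype.ext (by simp)) }
  let Ψ : ↥B' →+ ↥inv ⧸ img.addSubgroupOf inv := (QuotientAddGroup.mk' (img.addSubgroupOf inv)).comp Ψ₀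
  have hΨsurj : Function.Surjective Ψ := by
    intro q
    obtain ⟨y, rfl⟩ := QuotientAddGroup.mk'_surjective (img.addSubgroupOf inv) q
    have hy2 : (y : ↥Sinf) ∈ endInvariants (conjRestricted κ M 𝔮 γ - 1) := y.2
    have hyinv : conjH1 κ.kerSubgroup M (γ ^ p ^ 0) ((y : ↥Sinf) : subgroupH1 κ.kerSubgroup M) = (y : ↥Sinf) := by
      rw [pow_zero, pow_one]
      exact (mem_endInvariants_conjRestricted_iff (y : ↥Sinf)).mp hy2
    obtain ⟨x, hx⟩ := exists_resOfLe_eq_of_conjH1_eq κ M 0 hγ hcont hprim _ hyinv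
    have hxB : x ∈ B' := by
      rw [hB', AddSubgroup.mem_comap]
      have hRx : R x = ((y : ↥Sinf) : subgroupH1 κ.kerSubgroup M) := hx
      rw [hRx]
      exact (y : ↥Sinf).2
    refine ⟨⟨x, hxB⟩, ?_⟩
    change QuotientAddGroup.mk' _ (Ψ₀ ⟨x, hxB⟩) = QuotientAddGroup.mk' _ y
    congr 1
    exact Subtype.ext (Subtype.ext hx)
  have hkerΨ : ∀ x ∈ S0.addSubgroupOf B', Ψ x = 0 := by
    intro x hx
    rw [AddSubgroup.mem_addSubgroupOf] at hx
    change QuotientAddGroup.mk' _ (Ψ₀ x) = 0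
    rw [QuotientAddGroup.mk'_apply, QuotientAddGroup.eq_zero_iff, AddSubgroup.mem_addSubgroupOf, himg,
      AddSubgroup.mem_addSubgroupOf, himg_eq]
    exact AddSubgroup.mem_map_of_mem R hx
  -- conclude
  have hsurj' : Function.Surjective (QuotientAddGroup.lift (S0.addSubgroupOf B') Ψ hkerΨ) := by
    intro q
    obtain ⟨x, rfl⟩ := hΨsurj q
    exact ⟨QuotientAddGroup.mk x, rfl⟩
  have hrel : img.relIndex inv = Nat.card (↥inv ⧸ img.addSubgroupOf inv) := rfl
  rw [hrel]
  exact (Nat.card_le_card_of_surjective _ hsurj').trans hcardQ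

end Coker

end Summit.BirchSwinnertonDyer.BirchSwinnertonDyer.Theorems.PrintCf2.RestrictedSelmerPair

end
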